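import Literature.MathematicalPhysics.QuantumFieldTheory.Balaban1983to89.B9Eq326ConjugatedDeltaATwoBackgroundsGroupPencil
import Literature.MathematicalPhysics.QuantumFieldTheory.Balaban1983to89.B9Eq326ConjugatedDeltaATwoBackgroundsPencil

/-!
# `Balaban1983to89.B9Eq326ConjugatedDeltaATwoBackgroundsGroupPencilBase` — T. Bałaban, *Propagators for lattice gauge theories in a background field*,
# Commun. Math. Phys. **99** (1985) 389–434 [Balaban1985BackgroundPropagators] Thm 3.4 p. 400, (3.86) p. 407, Thm 3.11 p. 416, with T. Kato (1966) [Kato1966]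
# Ch. VII §4: **THE GROUP PENCIL AGAINST ITS REAL BASE POINT — when the family passes through the base (`H_κ(U_0) = H_κ(U)`), every member of the
# disc differs from the base inverse by `‖H_κ(U_z)⁻¹ − H_κ(U)⁻¹‖ ≤ (γ′ − Θ)⁻¹∕(R₁ − r)·‖z‖` (road (α)'s two-background difference recovered as the
# pencil's Lipschitz constant, with NO weight comparison and NO unconjugated letter), the base inverse IS (CDT)'s right inverse `G_κ(U)`
# (`…TwoBackgroundsPencil.inverse_conjH_apply_eq_rightInv` BY NAME), and the Cauchy majorants hold at ANY centre of the disc** — corollaries of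
# `B9Eq326ConjugatedDeltaATwoBackgroundsGroupPencil` (N54 junction) for its consumers

statement-level skeleton of published theorems with citation tags; proofs where landed; nothing here is a claim about the Yang–Mills mass gap

CITATION HEADER (lean-in-tree rule).  Audit cell `pub-balaban`, sub-cell `t4`, BINDER row NE9; filed by NE9 formalisation-swarm LEAF PROVER 01
(`b2b-balaban-t4-ne9-formalise-leaf-01`, gen 89) as the consumer-facing tail of N54 (t4-ne9-idea-1 g153, card `t4/ideate/NE9/lens1-g153/N54-GROUP-PENCIL-g153.md`
§3 last bullet: «for two REAL backgrounds on the pencil `V = U·e^{tηA}`, `|t| ≤ r < ρ⋆`: `‖G_κ(V) − G_κ(U)‖ ≤ (γ′ − θ)⁻¹∕(ρ⋆ − r)·|t|`»).  Imports this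
lineage's `…GroupPencil` (gen 89) and `…TwoBackgroundsPencil` (gen 88, for `inverse_conjH_apply_eq_rightInv`).  Sources READ first-hand
(`paper:balaban1985-cmp99-background-propagators`, journal page = PDF page + 388): p. 400 Thm 3.4 *«small perturbations of the operators depending on U
only»*, p. 407 (3.86), p. 416 Thm 3.11.  Print's road is the sup-norm Neumann series; the FORM-currency pencil is the ROUTE's substitute
(`t4/ROUTES-NE9.md` §L1.4); nothing of print's radius is asserted.

WHAT IS PROVED (sorry-free; proof lane — no `def`; [folklore] composition BY NAME).  Binders = `…GroupPencil`'s (structure AT `U`, the letter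
FAMILY, disc-uniform difference letters, `hHa`, `hgap`) plus, where stated, `h0 : HkZ 0 = HkU` (the family passes through the base) and
`hGU : ∀ v, HkU (GkU v) = v` ((CDT)'s right inverse at `U`).
* **`norm_inverse_conjH_gpencil_sub_base_le`**: `r < R₁`, `‖z‖ ≤ r`, `h0` ⟹ `‖H_κ(U_z)⁻¹ − H_κ(U)⁻¹‖ ≤ (γ′ − Θ)⁻¹∕(R₁ − r)·‖z‖`.
* **`norm_inverse_conjH_gpencil_apply_sub_rightInv_le`**: `+ hGU` ⟹ `‖H_κ(U_z)⁻¹y − G_κ(U)y‖ ≤ (γ′ − Θ)⁻¹∕(R₁ − r)·‖z‖·‖y‖` — the member's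
  inverse against (CDT)'s `S∘G₁,k(U)∘S⁻¹` pointwise.
* **`norm_iteratedDeriv_inverse_conjH_gpencil_le_at`**: `0 < r`, `‖z₀‖ + r ≤ R₁` ⟹ `‖iteratedDeriv n (w ↦ H_κ(U_w)⁻¹) z₀‖ ≤ n!·(γ′ − Θ)⁻¹∕rⁿ`.
MODEL ∕ HONEST SCOPE.  As `…GroupPencil` (M1)–(M4): abstract finite-dimensional complex Hilbert letters; DISPLAYED `γ`, the (CDA) letters at `U`, the
`δ_•`, `hHa`, `R₁`; the Lipschitz constant is per unit of the PENCIL PARAMETER; no lattice object, no rate, no window evaluated; not print's Thm 3.4 ∕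
(3.86) in operator ∕ kernel currency.  NOT NE9 (cell pub-balaban: NE9 NOT PRINTED ∕ NOT PROVED; «NE9 ⇐ the named binders»; row WALLED ON A MODEL
(O-NE9-1; #5 UNRULED); spine PROVED 0∕9; rung (B)+1 on a finite T⁴ — NOT infinite volume, NOT mass gap, NOT BetaPertH, NOT Clay).  HONEST DEPENDENCY
(cell line): continuum YM on T⁴ ⇐ BetaPertH ∧ nine spine estimates (0/9 proved); BetaPertH ⇐ (D1) ∧ (D4) ∧ CAP+tail; G-an2-4 gates asym, D1 and
NE2/3/4.  NEW file; nothing modified.  Net new unproved facts: 0.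
-/

noncomputable section

open scoped InnerProductSpace ComplexConjugate
open Metric Set

namespace Literature.MathematicalPhysics.QuantumFieldTheory.Balaban1983to89.B9Eq326ConjugatedDeltaATwoBackgroundsGroupPencilBase

open B9Eq326ConjugatedDeltaAEnergyWeight (weightU_nonneg norm_le_weightU coerciveN_k)
open B9Eq326ConjugatedDeltaATwoBackgroundsPencil (inverse_conjH_apply_eq_rightInv)
open B9Eq326ConjugatedDeltaATwoBackgroundsGroupPencil (norm_inverse_conjH_gpencil_sub_le analyticAt_inverse_conjH_gpencil
  norm_inverse_conjH_gpencil_le)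

variable {E : Type*} [NormedAddCommGroup E] [InnerProductSpace ℂ E] [FiniteDimensional ℂ E]
  {P : Type*} [NormedAddCommGroup P] [InnerProductSpace ℂ P] [FiniteDimensional ℂ P]
  {S : Type*} [NormedAddCommGroup S] [InnerProductSpace ℂ S] [FiniteDimensional ℂ S]
  {F : Type*} [NormedAddCommGroup F] [InnerProductSpace ℂ F] [FiniteDimensional ℂ F]

section GroupPencil

variable {B₁U : E →ₗ[ℂ] P} {B₂U : E →ₗ[ℂ] S} {RU : S →ₗ[ℂ] S} {QU : E →ₗ[ℂ] F} {KU HU : E →ₗ[ℂ] E}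
  {a γ β βK pK ρ CP : ℝ}
  {B₁kU : E →ₗ[ℂ] P} {B₁k'U : P →ₗ[ℂ] E} {B₂kU : E →ₗ[ℂ] S} {B₂k'U : S →ₗ[ℂ] E} {RkU : S →ₗ[ℂ] S}
  {QkU : E →ₗ[ℂ] F} {Qk'U : F →ₗ[ℂ] E} {KkU HkU : E →ₗ[ℂ] E}
  -- the family along the pencil (print's `U_z = U·e^{zηA}`, conjugated): one (CDA)-shaped structure per `z`
  {B₁kZ : ℂ → (E →ₗ[ℂ] P)} {B₁k'Z : ℂ → (P →ₗ[ℂ] E)} {B₂kZ : ℂ → (E →ₗ[ℂ] S)} {B₂k'Z : ℂ → (S →ₗ[ℂ] E)} {RkZ : ℂ → (S →ₗ[ℂ] S)}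
  {QkZ : ℂ → (E →ₗ[ℂ] F)} {Qk'Z : ℂ → (F →ₗ[ℂ] E)} {KkZ HkZ : ℂ → (E →ₗ[ℂ] E)}
  (ha : 0 ≤ a) (hβ : 0 ≤ β) (hρ : 0 ≤ ρ) (hρ8 : ρ ≤ 1 / 8) (hCP : 0 ≤ CP)
  (small' : 3 / 4 * pK + (21 + 3 * a) * β ^ 2 + 4 * β * CP + 2 * ρ * CP ^ 2 + βK ≤ γ / 8)
  -- the structure at the REAL base point `U` (every SIZE letter lives here)
  (hRsqU : ∀ s, RCLike.re ⟪s, RU s⟫_ℂ = ‖RU s‖ ^ 2) (hR1U : ∀ s, ‖RU s‖ ≤ ‖s‖)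
  (hHU : ∀ f, HU f = LinearMap.adjoint B₁U (B₁U f) + LinearMap.adjoint B₂U (RU (B₂U f)) + KU f + ((a : ℝ) : ℂ) • LinearMap.adjoint QU (QU f))
  (coerciveU : ∀ f, γ * ‖f‖ ^ 2 ≤ RCLike.re ⟪f, HU f⟫_ℂ) (hKreU : ∀ f, -(pK * ‖f‖ ^ 2) ≤ RCLike.re ⟪f, KU f⟫_ℂ)
  (hPU : ∀ f, ‖B₂U f - RU (B₂U f)‖ ≤ CP * ‖f‖)
  (dB₁U : ∀ f, ‖B₁kU f - B₁U f‖ ≤ β * ‖f‖) (dB₁'U : ∀ p, ‖B₁k'U p - LinearMap.adjoint B₁U p‖ ≤ β * ‖p‖)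
  (dB₂U : ∀ f, ‖B₂kU f - B₂U f‖ ≤ β * ‖f‖) (dB₂'U : ∀ s, ‖B₂k'U s - LinearMap.adjoint B₂U s‖ ≤ β * ‖s‖)
  (dRU : ∀ s, ‖RkU s - RU s‖ ≤ ρ * ‖s‖)
  (dQU : ∀ f, ‖QkU f - QU f‖ ≤ β * ‖f‖) (dQ'U : ∀ g, ‖Qk'U g - LinearMap.adjoint QU g‖ ≤ β * ‖g‖)
  (dKU : ∀ f, ‖KkU f - KU f‖ ≤ βK * ‖f‖)
  (hHkU : ∀ f, HkU f = B₁k'U (B₁kU f) + B₂k'U (RkU (B₂kU f)) + KkU f + ((a : ℝ) : ℂ) • Qk'U (QkU f))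
  -- the family's structure equation at every `z`
  (hHkZ : ∀ (z : ℂ) (f : E), HkZ z f = B₁k'Z z (B₁kZ z f) + B₂k'Z z (RkZ z (B₂kZ z f)) + KkZ z f + ((a : ℝ) : ℂ) • Qk'Z z (QkZ z f))
  -- the radius and the DIFFERENCE letters, uniform on the closed disc (no size letter at any complex member)
  {R₁ : ℝ} (hR₁ : 0 < R₁)
  {δ₁ δ₂ δR δQ δK : ℝ} (hδ₁ : 0 ≤ δ₁) (hδ₂ : 0 ≤ δ₂) (hδR : 0 ≤ δR) (hδQ : 0 ≤ δQ) (hδK : 0 ≤ δK)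
  (tB₁ : ∀ z : ℂ, ‖z‖ ≤ R₁ → ∀ f, ‖B₁kZ z f - B₁kU f‖ ≤ δ₁ * ‖f‖) (tB₁' : ∀ z : ℂ, ‖z‖ ≤ R₁ → ∀ p, ‖B₁k'Z z p - B₁k'U p‖ ≤ δ₁ * ‖p‖)
  (tB₂ : ∀ z : ℂ, ‖z‖ ≤ R₁ → ∀ f, ‖B₂kZ z f - B₂kU f‖ ≤ δ₂ * ‖f‖) (tB₂' : ∀ z : ℂ, ‖z‖ ≤ R₁ → ∀ s, ‖B₂k'Z z s - B₂k'U s‖ ≤ δ₂ * ‖s‖)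
  (tR : ∀ z : ℂ, ‖z‖ ≤ R₁ → ∀ s, ‖RkZ z s - RkU s‖ ≤ δR * ‖s‖)
  (tQ : ∀ z : ℂ, ‖z‖ ≤ R₁ → ∀ f, ‖QkZ z f - QkU f‖ ≤ δQ * ‖f‖) (tQ' : ∀ z : ℂ, ‖z‖ ≤ R₁ → ∀ g, ‖Qk'Z z g - Qk'U g‖ ≤ δQ * ‖g‖)
  (tK : ∀ z : ℂ, ‖z‖ ≤ R₁ → ∀ f, ‖KkZ z f - KkU f‖ ≤ δK * ‖f‖)
  -- analyticity of the family (at the lattice: a PAIR-typed chain of entire words in the pencil letters and their transposes; §1 reduces it to the letters)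
  (hHa : ∀ z : ℂ, ‖z‖ ≤ R₁ → AnalyticAt ℂ (fun w : ℂ => (LinearMap.toContinuousLinearMap (HkZ w) : E →L[ℂ] E)) z)
  -- the gap
  (hgap : (((1 + β) * δ₁ + δ₁ * (1 + β) + δ₁ * δ₁) +
          ((1 + CP + β) * ((1 + ρ) * δ₂ + δR * (1 + CP + β + δ₂)) + δ₂ * ((1 + ρ) * (1 + CP + β)) +
            δ₂ * ((1 + ρ) * δ₂ + δR * (1 + CP + β + δ₂))) +
          δK + ((Real.sqrt a + |a| * β) * δQ + δQ * (Real.sqrt a + |a| * β) + |a| * (δQ * δQ))) < min (1 / 4) (γ / 8))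


include ha hβ hρ hρ8 hCP small' hRsqU hR1U hHU coerciveU hKreU hPU dB₁U dB₁'U dB₂U dB₂'U dRU dQU dQ'U dKU hHkU hHkZ hδ₁ hδ₂ hδR hδQ hδK tB₁ tB₁' tB₂ tB₂' tR tQ tQ' tK hHa hgap in
/-- **EVERY MEMBER AGAINST THE BASE**: if the family passes through the base point (`H_κ(U_0) = H_κ(U)`), then for `r < R₁` and `‖z‖ ≤ r` (so `0 ≤ r`;
ne9-leaf-04 g84's L-leaf04-g84-1):
`‖H_κ(U_z)⁻¹ − H_κ(U)⁻¹‖ ≤ (γ′ − Θ)⁻¹∕(R₁ − r)·‖z‖` — road (α)'s two-background difference as the group pencil's Lipschitz constant, with NO weight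
comparison and NO unconjugated letter (`…GroupPencil.norm_inverse_conjH_gpencil_sub_le` at `w = 0`). [folklore]
[cite: Balaban1985BackgroundPropagators, Thm 3.4 p.400, (3.86) p.407; Kato1966, Ch. VII §4] -/
theorem norm_inverse_conjH_gpencil_sub_base_le (h0 : HkZ 0 = HkU) {r : ℝ} (hr : r < R₁) {z : ℂ} (hz : ‖z‖ ≤ r) :
    ‖Ring.inverse (LinearMap.toContinuousLinearMap (HkZ z) : E →L[ℂ] E) - Ring.inverse (LinearMap.toContinuousLinearMap HkU : E →L[ℂ] E)‖ ≤ (min (1 / 4) (γ / 8) - (((1 + β) * δ₁ + δ₁ * (1 + β) + δ₁ * δ₁) +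
          ((1 + CP + β) * ((1 + ρ) * δ₂ + δR * (1 + CP + β + δ₂)) + δ₂ * ((1 + ρ) * (1 + CP + β)) +
            δ₂ * ((1 + ρ) * δ₂ + δR * (1 + CP + β + δ₂))) +
          δK + ((Real.sqrt a + |a| * β) * δQ + δQ * (Real.sqrt a + |a| * β) + |a| * (δQ * δQ))))⁻¹ / (R₁ - r) * ‖z‖ := by
  have h := norm_inverse_conjH_gpencil_sub_le ha hβ hρ hρ8 hCP small' hRsqU hR1U hHU coerciveU hKreU hPU dB₁U dB₁'U dB₂U dB₂'U dRU dQU dQ'U dKU hHkU hHkZ hδ₁ hδ₂ hδR hδQ hδK tB₁ tB₁' tB₂ tB₂' tR tQ tQ' tK hHa hgap hr hz (w := 0)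
    (by simpa using (norm_nonneg z).trans hz)
  rw [h0, sub_zero] at h
  exact h

include ha hβ hρ hρ8 hCP small' hRsqU hR1U hHU coerciveU hKreU hPU dB₁U dB₁'U dB₂U dB₂'U dRU dQU dQ'U dKU hHkU hHkZ hδ₁ hδ₂ hδR hδQ hδK tB₁ tB₁' tB₂ tB₂' tR tQ tQ' tK hHa hgap in
/-- **… POINTWISE AGAINST (CDT)'s RIGHT INVERSE**: with `H_κ(U)G_κ(U) = 1` in addition, `‖H_κ(U_z)⁻¹y − G_κ(U)y‖ ≤ (γ′ − Θ)⁻¹∕(R₁ − r)·‖z‖·‖y‖`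
(`…TwoBackgroundsPencil.inverse_conjH_apply_eq_rightInv` identifies the base inverse with `S∘G₁,k(U)∘S⁻¹`). [folklore]
[cite: Balaban1985BackgroundPropagators, Thm 3.4 p.400, Thm 3.11 p.416; Balaban1985Variational, (110) p.294] -/
theorem norm_inverse_conjH_gpencil_apply_sub_rightInv_le {GkU : E →ₗ[ℂ] E} (hGU : ∀ v, HkU (GkU v) = v) (h0 : HkZ 0 = HkU)
    {r : ℝ} (hr : r < R₁) {z : ℂ} (hz : ‖z‖ ≤ r) (y : E) :
    ‖Ring.inverse (LinearMap.toContinuousLinearMap (HkZ z) : E →L[ℂ] E) y - GkU y‖ ≤ (min (1 / 4) (γ / 8) - (((1 + β) * δ₁ + δ₁ * (1 + β) + δ₁ * δ₁) +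
          ((1 + CP + β) * ((1 + ρ) * δ₂ + δR * (1 + CP + β + δ₂)) + δ₂ * ((1 + ρ) * (1 + CP + β)) +
            δ₂ * ((1 + ρ) * δ₂ + δR * (1 + CP + β + δ₂))) +
          δK + ((Real.sqrt a + |a| * β) * δQ + δQ * (Real.sqrt a + |a| * β) + |a| * (δQ * δQ))))⁻¹ / (R₁ - r) * ‖z‖ * ‖y‖ := by
  have hco := coerciveN_k B₁U B₂U RU QU KU HU a γ β βK pK ρ CP B₁kU B₁k'U B₂kU B₂k'U RkU QkU Qk'U KkU HkU ha hβ hρ hCP hRsqU hR1U hHU coerciveU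
    hKreU dB₁U dB₁'U dB₂U dB₂'U dRU dQU dQ'U dKU small' hHkU hρ8 hPU
  have hγ' : 0 < min (1 / 4 : ℝ) (γ / 8) := by
    have hΘ : 0 ≤ (((1 + β) * δ₁ + δ₁ * (1 + β) + δ₁ * δ₁) +
          ((1 + CP + β) * ((1 + ρ) * δ₂ + δR * (1 + CP + β + δ₂)) + δ₂ * ((1 + ρ) * (1 + CP + β)) +
            δ₂ * ((1 + ρ) * δ₂ + δR * (1 + CP + β + δ₂))) +
          δK + ((Real.sqrt a + |a| * β) * δQ + δQ * (Real.sqrt a + |a| * β) + |a| * (δQ * δQ))) := by positivity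
    linarith
  have hG : Ring.inverse (LinearMap.toContinuousLinearMap HkU : E →L[ℂ] E) y = GkU y :=
    inverse_conjH_apply_eq_rightInv (fun f => Real.sqrt (‖B₁U f‖ ^ 2 + ‖RU (B₂U f)‖ ^ 2 + a * ‖QU f‖ ^ 2 + ‖f‖ ^ 2)) (norm_le_weightU B₁U B₂U RU QU a ha) hγ' hco hGU y
  have h := norm_inverse_conjH_gpencil_sub_base_le ha hβ hρ hρ8 hCP small' hRsqU hR1U hHU coerciveU hKreU hPU dB₁U dB₁'U dB₂U dB₂'U dRU dQU dQ'U dKU hHkU hHkZ hδ₁ hδ₂ hδR hδQ hδK tB₁ tB₁' tB₂ tB₂' tR tQ tQ' tK hHa hgap h0 hr hz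
  calc ‖Ring.inverse (LinearMap.toContinuousLinearMap (HkZ z) : E →L[ℂ] E) y - GkU y‖
      = ‖(Ring.inverse (LinearMap.toContinuousLinearMap (HkZ z) : E →L[ℂ] E) - Ring.inverse (LinearMap.toContinuousLinearMap HkU : E →L[ℂ] E)) y‖ := by
        rw [sub_apply, hG]
    _ ≤ ‖Ring.inverse (LinearMap.toContinuousLinearMap (HkZ z) : E →L[ℂ] E) - Ring.inverse (LinearMap.toContinuousLinearMap HkU : E →L[ℂ] E)‖ * ‖y‖ := ContinuousLinearMap.le_opNorm _ _
    _ ≤ (min (1 / 4) (γ / 8) - (((1 + β) * δ₁ + δ₁ * (1 + β) + δ₁ * δ₁) +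
          ((1 + CP + β) * ((1 + ρ) * δ₂ + δR * (1 + CP + β + δ₂)) + δ₂ * ((1 + ρ) * (1 + CP + β)) +
            δ₂ * ((1 + ρ) * δ₂ + δR * (1 + CP + β + δ₂))) +
          δK + ((Real.sqrt a + |a| * β) * δQ + δQ * (Real.sqrt a + |a| * β) + |a| * (δQ * δQ))))⁻¹ / (R₁ - r) * ‖z‖ * ‖y‖ := mul_le_mul_of_nonneg_right h (norm_nonneg y)

include ha hβ hρ hρ8 hCP small' hRsqU hR1U hHU coerciveU hKreU hPU dB₁U dB₁'U dB₂U dB₂'U dRU dQU dQ'U dKU hHkU hHkZ hδ₁ hδ₂ hδR hδQ hδK tB₁ tB₁' tB₂ tB₂' tR tQ tQ' tK hHa hgap in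
/-- **CAUCHY AT EVERY ORDER, ANY CENTRE OF THE DISC**: for `0 < r` and `‖z₀‖ + r ≤ R₁`,
`‖iteratedDeriv n (w ↦ H_κ(U_w)⁻¹) z₀‖ ≤ n!·(γ′ − Θ)⁻¹∕rⁿ` (Cauchy on `ball z₀ r ⊆ closedBall 0 R₁` with the uniform inverse bound). [folklore]
[cite: Balaban1985BackgroundPropagators, Thm 3.4 p.400, (3.86) p.407; Kato1966, Ch. VII §4] -/
theorem norm_iteratedDeriv_inverse_conjH_gpencil_le_at {z₀ : ℂ} {r : ℝ} (hr : 0 < r) (hzr : ‖z₀‖ + r ≤ R₁) (n : ℕ) :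
    ‖iteratedDeriv n (fun w : ℂ => Ring.inverse (LinearMap.toContinuousLinearMap (HkZ w) : E →L[ℂ] E)) z₀‖ ≤ n.factorial * (min (1 / 4) (γ / 8) - (((1 + β) * δ₁ + δ₁ * (1 + β) + δ₁ * δ₁) +
          ((1 + CP + β) * ((1 + ρ) * δ₂ + δR * (1 + CP + β + δ₂)) + δ₂ * ((1 + ρ) * (1 + CP + β)) +
            δ₂ * ((1 + ρ) * δ₂ + δR * (1 + CP + β + δ₂))) +
          δK + ((Real.sqrt a + |a| * β) * δQ + δQ * (Real.sqrt a + |a| * β) + |a| * (δQ * δQ))))⁻¹ / r ^ n := by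
  have hsub : closedBall z₀ r ⊆ closedBall (0 : ℂ) R₁ := by
    intro y hy
    have hy' : ‖y - z₀‖ ≤ r := by simpa [dist_eq_norm] using hy
    have : ‖y‖ ≤ ‖y - z₀‖ + ‖z₀‖ := by
      calc ‖y‖ = ‖(y - z₀) + z₀‖ := by rw [sub_add_cancel]
        _ ≤ ‖y - z₀‖ + ‖z₀‖ := norm_add_le _ _
    simpa using (this.trans (by linarith))
  have hdiff : DifferentiableOn ℂ (fun w : ℂ => Ring.inverse (LinearMap.toContinuousLinearMap (HkZ w) : E →L[ℂ] E)) (closedBall 0 R₁) := fun z hz =>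
    (analyticAt_inverse_conjH_gpencil ha hβ hρ hρ8 hCP small' hRsqU hR1U hHU coerciveU hKreU hPU dB₁U dB₁'U dB₂U dB₂'U dRU dQU dQ'U dKU hHkU hHkZ hδ₁ hδ₂ hδR hδQ hδK tB₁ tB₁' tB₂ tB₂' tR tQ tQ' tK hHa hgap (by simpa using hz)).differentiableAt.differentiableWithinAt
  have hdc : DiffContOnCl ℂ (fun w : ℂ => Ring.inverse (LinearMap.toContinuousLinearMap (HkZ w) : E →L[ℂ] E)) (ball z₀ r) := hdiff.diffContOnCl_ball hsub
  exact Complex.norm_iteratedDeriv_le_of_forall_mem_sphere_norm_le n hr hdc fun z hz =>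
    norm_inverse_conjH_gpencil_le ha hβ hρ hρ8 hCP small' hRsqU hR1U hHU coerciveU hKreU hPU dB₁U dB₁'U dB₂U dB₂'U dRU dQU dQ'U dKU hHkU hHkZ hδ₁ hδ₂ hδR hδQ hδK tB₁ tB₁' tB₂ tB₂' tR tQ tQ' tK hgap (by simpa using hsub (sphere_subset_closedBall hz))

end GroupPencil

end Literature.MathematicalPhysics.QuantumFieldTheory.Balaban1983to89.B9Eq326ConjugatedDeltaATwoBackgroundsGroupPencilBase

end
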